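import Mathlib
import Literature.Analysis.FluidPDE.Tao2016AveragedNS.SelfSimilarCascadeBlowup
import Literature.Barriers.NavierStokesRegularity.DyadicCascadeRegularityProofs
import HarnessLib

/-!
# Scaled dyadic tables at ANY scale ratio: the off-chain modes are harmless
# (helper file for the crux `SubOnsagerCeiling.ForwardTailCeilingKP`, stmt-NavierStokesRegularity-27057, `--supports`;
# hand leafhand-ns-subonsagerceiling-4 gen 23; route-independent module — no `Theses` import)

For the one-mode chain class `α = c·dyadicTable` (the skeleton's `IsScaledDyadic`), every weighted-barrier obligation of the
crux family (the registered stubs' `PrimaryGradedAt`, the total `ShellBarrierAt`, their per-viscosity versions of gen 23) is an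
obligation on the CHAIN MODE `0` alone: along any honest `ν`-viscous solution (`ν ≥ 0`) of the lattice (4.13) from a one-shell
datum, the components `i ≠ 0` carry no nonlinearity (`quadTerm_dyadicTable_of_ne`), so `X_{i,k}²` is non-increasing; hence
`X_{i,k} ≡ 0` on the shells `k ≥ 1` and `½X_{i,0}(t)² ≤ ½(X₀ i)² ≤ E₀` — at EVERY ratio `1+ε₀`, every weight exponent `θ`.
The lead's `ε₀ = 1` rung (`dyadicRatioTwo_shellBarrier`, p610572) inlines this step at ratio `2`; here it is recorded once for all
ratios, so that a chain theorem at ratio `1+ε₀` (the open Barbato–Morandin–Romito-type statement, cf. the per-viscosity socket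
`Theorems/SubOnsagerCeilingKPChainViscousGlobal.lean`) transfers to the four-mode currency of the stubs with no further work:

* `scaledDyadic_offChain_sq_le` — `X_{i,k}(t)² ≤ X_{i,k}(0)²` for `i ≠ 0`, `t ∈ [0,s]`;
* `scaledDyadic_offChain_barrier` — `(1+ε₀)^{2θk}·½X_{i,k}(t)² ≤ E₀` for `i ≠ 0`, every `k : ℕ`, every real `θ`;
* `scaledDyadic_barrier_of_chainMode` — a weighted barrier `(1+ε₀)^{2θk}·½X_{0,k}(t)² ≤ D·E₀` of the chain mode gives the
  same barrier for ALL modes with constant `max D 1`.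

HONEST FRAMING: elementary bookkeeping about Tao-type MODEL lattice ODEs (route SubOnsagerCeiling, rung TL-M2Break); nothing is
proved about the chain mode itself; no stub, crux, rung target or summit is proved and nothing bears on Navier–Stokes.
[cite: Tao2016AveragedNS, §1.2, §4 (4.13)]
-/

noncomputable section

-- the sub-problem namespace `NavierStokesRegularity.NavierStokesRegularity` is the tree's layout (D-0017)
set_option linter.dupNamespace false

namespace Summit.NavierStokesRegularity.NavierStokesRegularity.Theorems

open Set
open Literature.Analysis.FluidPDE.TaoCascade
open Literature.Barriers.NavierStokesRegularity.Dyadic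

/-- **Off-chain modes do not grow.**  For `α = c·dyadicTable` and an honest `ν`-viscous solution on `[0,s]` (`ν ≥ 0`), every
component `i ≠ 0` obeys `X_{i,k}(t)² ≤ X_{i,k}(0)²` for `t ∈ [0,s]`: its equation is the pure decay `Ẋ = −ν(1+ε₀)^{2k}X`.
MODEL lattice statement. [cite: Tao2016AveragedNS, §4 (4.13)] -/
theorem scaledDyadic_offChain_sq_le {ε₀ ν c s : ℝ} (hε : 0 < ε₀) (hν : 0 ≤ ν)
    {α : Fin 4 → Fin 4 → Fin 4 → ℤ × ℤ × ℤ → ℝ}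
    (hα : ∀ (i₁ i₂ i₃ : Fin 4) (μ : ℤ × ℤ × ℤ), α i₁ i₂ i₃ μ = c * dyadicTable i₁ i₂ i₃ μ)
    {X : Fin 4 → ℤ → ℝ → ℝ}
    (hode : ∀ (i : Fin 4) (k : ℤ), ∀ t ∈ Icc (0 : ℝ) s, HasDerivWithinAt (X i k)
      (quadTerm ε₀ α X i k t - ν * (1 + ε₀) ^ ((2 : ℝ) * k) * X i k t) (Icc (0 : ℝ) s) t)
    {i : Fin 4} (hi : i ≠ 0) (k : ℤ) :
    ∀ t ∈ Icc (0 : ℝ) s, X i k t ^ 2 ≤ X i k 0 ^ 2 := by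
  have hb : (0 : ℝ) < 1 + ε₀ := by linarith
  have hQ : ∀ t, quadTerm ε₀ α X i k t = 0 := by
    intro t
    have hlin : quadTerm ε₀ α X i k t = c * quadTerm ε₀ dyadicTable X i k t := by
      simp only [quadTerm, hα, Finset.mul_sum]
      refine Finset.sum_congr rfl fun i₁ _ => Finset.sum_congr rfl fun i₂ _ =>
        Finset.sum_congr rfl fun μ _ => ?_
      ring
    rw [hlin, quadTerm_dyadicTable_of_ne ε₀ X hi, mul_zero]
  have hd : ∀ τ ∈ Icc (0 : ℝ) s, HasDerivWithinAt (fun r => X i k r ^ 2)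
      (2 * X i k τ * (0 - ν * (1 + ε₀) ^ ((2 : ℝ) * k) * X i k τ)) (Icc (0 : ℝ) s) τ := by
    intro τ hτ
    have h := hode i k τ hτ
    rw [hQ τ] at h
    exact hasDerivWithinAt_sq h
  have hle := le_add_mul_of_deriv_le_Icc hd (C := 0) (fun τ _ => by
    have hw : 0 ≤ ν * (1 + ε₀) ^ ((2 : ℝ) * k) := mul_nonneg hν (Real.rpow_nonneg hb.le _)
    nlinarith [sq_nonneg (X i k τ)])
  intro t ht
  have := hle t ht
  linarith

/-- **Off-chain modes are harmless for every weighted barrier.**  For `α = c·dyadicTable`, an honest `ν`-viscous solution on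
`[0,s]` from the one-shell datum `X₀` obeys, for every component `i ≠ 0`, every shell `k : ℕ`, every real `θ` and every
`t ∈ [0,s]`: `(1+ε₀)^{2θk}·½X_{i,k}(t)² ≤ Σ_j ½(X₀ j)²` (shell `0`: the weight is `1` and the mode does not grow; shells `≥ 1`:
the mode vanishes identically). MODEL lattice statement. [cite: Tao2016AveragedNS, §4 (4.13)] -/
theorem scaledDyadic_offChain_barrier {ε₀ ν c s : ℝ} (hε : 0 < ε₀) (hν : 0 ≤ ν)
    {α : Fin 4 → Fin 4 → Fin 4 → ℤ × ℤ × ℤ → ℝ}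
    (hα : ∀ (i₁ i₂ i₃ : Fin 4) (μ : ℤ × ℤ × ℤ), α i₁ i₂ i₃ μ = c * dyadicTable i₁ i₂ i₃ μ)
    {X₀ : Fin 4 → ℝ} {X : Fin 4 → ℤ → ℝ → ℝ}
    (hdat : ∀ (i : Fin 4) (k : ℤ), X i k 0 = if k = 0 then X₀ i else 0)
    (hode : ∀ (i : Fin 4) (k : ℤ), ∀ t ∈ Icc (0 : ℝ) s, HasDerivWithinAt (X i k)
      (quadTerm ε₀ α X i k t - ν * (1 + ε₀) ^ ((2 : ℝ) * k) * X i k t) (Icc (0 : ℝ) s) t)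
    {i : Fin 4} (hi : i ≠ 0) (k : ℕ) (θ : ℝ) :
    ∀ t ∈ Icc (0 : ℝ) s,
      (1 + ε₀) ^ (2 * θ * (k : ℝ)) * ((1 / 2 : ℝ) * X i (k : ℤ) t ^ 2) ≤ ∑ j : Fin 4, (1 / 2 : ℝ) * X₀ j ^ 2 := by
  intro t ht
  have hb : (0 : ℝ) < 1 + ε₀ := by linarith
  set E₀ : ℝ := ∑ j : Fin 4, (1 / 2 : ℝ) * X₀ j ^ 2 with hE₀
  have hE₀0 : 0 ≤ E₀ := Finset.sum_nonneg fun j _ => by positivity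
  have hE₀i : (1 / 2 : ℝ) * X₀ i ^ 2 ≤ E₀ :=
    Finset.single_le_sum (f := fun j => (1 / 2 : ℝ) * X₀ j ^ 2) (fun j _ => by positivity) (Finset.mem_univ i)
  have hsq := scaledDyadic_offChain_sq_le hε hν hα hode hi (k : ℤ) t ht
  rw [hdat i k] at hsq
  rcases Nat.eq_zero_or_pos k with rfl | hk
  · simp only [Nat.cast_zero, mul_zero, Real.rpow_zero, one_mul]
    simp only [Nat.cast_zero] at hsq
    simp only [if_true] at hsq
    calc (1 / 2 : ℝ) * X i 0 t ^ 2 ≤ (1 / 2 : ℝ) * X₀ i ^ 2 := by linarith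
      _ ≤ E₀ := hE₀i
  · rw [if_neg (by exact_mod_cast hk.ne')] at hsq
    have hX0 : X i (k : ℤ) t ^ 2 = 0 := le_antisymm (by simpa using hsq) (sq_nonneg _)
    rw [hX0, mul_zero, mul_zero]
    exact hE₀0

/-- **All weighted-barrier obligations of the chain class reduce to the chain mode.**  For `α = c·dyadicTable` and an honest
`ν`-viscous solution on `[0,s]` from the one-shell datum `X₀`: a barrier `(1+ε₀)^{2θk}·½X_{0,k}(t)² ≤ D·E₀` of the chain mode
(`k : ℕ`, `t ∈ [0,s]`) gives the same barrier for EVERY mode with constant `max D 1` — verbatim the shape of the skeleton's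
`PrimaryGradedAt` / `ShellBarrierAt` conclusions (any grading, e.g. `lev ≡ 0`). MODEL lattice statement.
[cite: Tao2016AveragedNS, §4 (4.13)] -/
theorem scaledDyadic_barrier_of_chainMode {ε₀ ν c s θ D : ℝ} (hε : 0 < ε₀) (hν : 0 ≤ ν)
    {α : Fin 4 → Fin 4 → Fin 4 → ℤ × ℤ × ℤ → ℝ}
    (hα : ∀ (i₁ i₂ i₃ : Fin 4) (μ : ℤ × ℤ × ℤ), α i₁ i₂ i₃ μ = c * dyadicTable i₁ i₂ i₃ μ)
    {X₀ : Fin 4 → ℝ} {X : Fin 4 → ℤ → ℝ → ℝ}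
    (hdat : ∀ (i : Fin 4) (k : ℤ), X i k 0 = if k = 0 then X₀ i else 0)
    (hode : ∀ (i : Fin 4) (k : ℤ), ∀ t ∈ Icc (0 : ℝ) s, HasDerivWithinAt (X i k)
      (quadTerm ε₀ α X i k t - ν * (1 + ε₀) ^ ((2 : ℝ) * k) * X i k t) (Icc (0 : ℝ) s) t)
    (hchain : ∀ t ∈ Icc (0 : ℝ) s, ∀ k : ℕ,
      (1 + ε₀) ^ (2 * θ * (k : ℝ)) * ((1 / 2 : ℝ) * X 0 (k : ℤ) t ^ 2) ≤ D * ∑ j : Fin 4, (1 / 2 : ℝ) * X₀ j ^ 2) :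
    ∀ t ∈ Icc (0 : ℝ) s, ∀ (i : Fin 4) (k : ℕ),
      (1 + ε₀) ^ (2 * θ * (k : ℝ)) * ((1 / 2 : ℝ) * X i (k : ℤ) t ^ 2) ≤ max D 1 * ∑ j : Fin 4, (1 / 2 : ℝ) * X₀ j ^ 2 := by
  intro t ht i k
  have hE₀0 : 0 ≤ ∑ j : Fin 4, (1 / 2 : ℝ) * X₀ j ^ 2 := Finset.sum_nonneg fun j _ => by positivity
  by_cases hi : i = 0
  · subst hi
    exact (hchain t ht k).trans (mul_le_mul_of_nonneg_right (le_max_left _ _) hE₀0)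
  · calc (1 + ε₀) ^ (2 * θ * (k : ℝ)) * ((1 / 2 : ℝ) * X i (k : ℤ) t ^ 2)
        ≤ ∑ j : Fin 4, (1 / 2 : ℝ) * X₀ j ^ 2 := scaledDyadic_offChain_barrier hε hν hα hdat hode hi k θ t ht
      _ = 1 * ∑ j : Fin 4, (1 / 2 : ℝ) * X₀ j ^ 2 := (one_mul _).symm
      _ ≤ max D 1 * ∑ j : Fin 4, (1 / 2 : ℝ) * X₀ j ^ 2 := mul_le_mul_of_nonneg_right (le_max_right _ _) hE₀0

end Summit.NavierStokesRegularity.NavierStokesRegularity.Theorems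

end
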